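import Literature.Analysis.FluidPDE.TaoForcedUniquenessBoundedEnstrophy
import Literature.Analysis.FluidPDE.TaoForcedNormalisedPressure
import Literature.Analysis.FluidPDE.NSVelocityUniqueness
import Literature.Analysis.FluidPDE.TaoY6WhitneySum
import HarnessLib

/-!
# Tao (2011/2013), Cor. 11.4 (unconditional uniqueness, arXiv Cor. 71) WITH FORCE, reduced to the
# bounded total speed of the two solutions (Prop. 9.1 WITH force)

Cell `pub/ns-blowup`, seat `ns-blowup-lean2` — PATH A of the E–C route's Literature leaf W14 =
`Literature.Analysis.FluidPDE.tao2011_forced_unconditionalUniqueness_velocity`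
(`TaoForcedNormalisedPressure.lean`; route `PalasekTowerBreakdown`, support item
`TaoForcedUniqueness`). WHAT THIS IS NOT: not a statement about Navier–Stokes blow-up — forced
uniqueness bookkeeping; and NOT yet the discharge `tao2011_forced_unconditionalUniqueness_velocity_holds`:
the printed chain (Remark 11.3: Lemma 8.1 ⇒ Cor. 11.1 ⇒ Cor. 4.3 + Thm. 5.4 (iii)) is proved here
WITH force except for its §9 input, Prop. 9.1 (bounded total speed, arXiv Prop. 52) WITH force, and
its §8 input, Lemma 8.1 (finite dissipation) WITH force, which enter as the hypotheses
`∫₀ᵀ‖u‖_{L^∞} < ∞`, `∫₀ᵀ∫|∇u|² < ∞` on each of the two solutions. (Lemma 8.1 WITH force is the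
tree's `IsClassicalNSSolutionOn.energyEq_of_finiteEnergy_forced_ae_of_fact` fed with
`tao2011_forced_pressure_normalisation_ae_holds`, for forces whose potential `Δ⁻¹∇·f` has `L²`
slices — e.g. Fefferman's Clay class; Prop. 9.1 WITH force is not yet in the tree.)

* `forceBudget_lt_top_of_H1` — smooth `H¹` data (`‖f‖_{L^∞_t H¹_x} < ∞`, Def. 1.1 p. 3) have
  finite force budget `‖∇ × f‖_{L¹_t L²_x([0,T] × ℝ³)} < ∞` (the form (10.1) consumes);
* `IsClassicalNSSolutionOn.memSobolevX_one_forced_of_totalSpeed` — Cor. 11.1 WITH force for a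
  solution with `H¹` data, finite energy, finite dissipation and finite total speed (the a priori
  theorem `memSobolevX_one_forced_of_apriori` with its two analytic leaves
  `tao2011_nonlinearEstimate_holds`, `tao2011_sobolev_of_vorticity_holds` discharged);
* `tao2011_forced_unconditionalUniqueness_velocity_of_totalSpeed` — **Cor. 11.4 WITH force, velocity
  form, in exactly the dictionary of the named fact `tao2011_forced_unconditionalUniqueness_velocity`,
  under the extra hypotheses of finite dissipation and finite total speed of both solutions**: the
  two solutions lie in `X¹` (previous item) and the tree's `IsClassicalNSSolutionOn.eq_of_memSobolevX`
  (Cor. 4.3 + Thm. 5.4 (iii), proved WITH a general force, `NSVelocityUniqueness.lean`) concludes.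

Everything is proved; no definition and no named fact is introduced (D-0026). What is missing for
`tao2011_forced_unconditionalUniqueness_velocity_holds` is recorded, not assumed under a new name.

## Mathlib / tree search

Tree: `IsClassicalNSSolutionOn.eq_of_memSobolevX` (force-general), `tao2011_nonlinearEstimate_holds`
(`TaoY6WhitneySum`), `tao2011_sobolev_of_vorticity_holds` (`TaoEnstrophyLocalisationProofs`),
`lintegral_curl_sq_le` (`TaoEnstrophyLocalisation`), the forced a priori Cor. 11.1
(`TaoForcedUniquenessBoundedEnstrophy`). `lean search 'forced_unconditionalUniqueness.*holds|of_totalSpeed' --decl`: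
nothing prior.

## References

* T. Tao, *Localisation and compactness properties of the Navier–Stokes global regularity
  problem*, Anal. PDE 6 (2013) 25–107 = arXiv:1108.1165 (`Tao2011`): Cor. 11.4 (arXiv Cor. 71,
  p. 36) with Remark 11.3 (arXiv Rem. 70), Cor. 11.1 (arXiv Cor. 68), Prop. 9.1 (arXiv Prop. 52),
  Lemma 8.1 (arXiv Lemma 44), Def. 1.1 (p. 3: `H¹` data).
-/

noncomputable section

open MeasureTheory Set Function Filter Topology
open scoped ENNReal NNReal RealInnerProductSpace ContDiff

namespace Literature.Analysis.FluidPDE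

section ForceBudget

variable {T : ℝ} {f : ℝ → EuclideanSpace ℝ (Fin 3) → EuclideanSpace ℝ (Fin 3)}

/-- **`H¹` data have finite force budget**: if `‖∇f(t)‖_{L²} ≤ C` uniformly on `[0,T]` (the
`j = 1` half of Tao's `‖f‖_{L^∞_t H¹_x} < ∞`, Def. 1.1) then
`∫₀ᵀ ‖∇ × f(t)‖_{L²(ℝ³)} dt ≤ T · ‖curl‖ · C^{1/2} < ∞` (pointwise `|∇ × f| ≤ ‖curl‖ |∇f|`).
[cite: Tao2011, Def. 1.1 (p. 3) with (10.1)] -/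
theorem forceBudget_lt_top_of_H1
    (hfH1 : ∀ j ≤ 1, ∃ C : ℝ≥0, ∀ t ∈ Icc 0 T, ∫⁻ x, ‖iteratedFDeriv ℝ j (f t) x‖ₑ ^ 2 ≤ C) :
    ∫⁻ t in Ioo 0 T, (∫⁻ x, ‖FluidPDE.curl (f t) x‖ₑ ^ 2) ^ (1 / 2 : ℝ) < ⊤ := by
  obtain ⟨C, hC⟩ := hfH1 1 le_rfl
  set B : ℝ≥0∞ := (ENNReal.ofReal (‖FluidPDE.curlCLM‖ ^ 2) * C) ^ (1 / 2 : ℝ) with hBdef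
  have hBtop : B < ⊤ := by
    refine ENNReal.rpow_lt_top_of_nonneg (by norm_num) ?_
    exact (ENNReal.mul_lt_top ENNReal.ofReal_lt_top ENNReal.coe_lt_top).ne
  have hpt : ∀ t ∈ Ioo 0 T, (∫⁻ x, ‖FluidPDE.curl (f t) x‖ₑ ^ 2) ^ (1 / 2 : ℝ) ≤ B := fun t ht =>
    ENNReal.rpow_le_rpow ((lintegral_curl_sq_le (f t)).trans
      (mul_le_mul_right (hC t (Ioo_subset_Icc_self ht)) _)) (by norm_num)
  calc ∫⁻ t in Ioo 0 T, (∫⁻ x, ‖FluidPDE.curl (f t) x‖ₑ ^ 2) ^ (1 / 2 : ℝ)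
      ≤ ∫⁻ _ in Ioo 0 T, B := setLIntegral_mono' measurableSet_Ioo hpt
    _ = B * volume (Ioo (0 : ℝ) T) := setLIntegral_const _ _
    _ < ⊤ := ENNReal.mul_lt_top hBtop (by simp)

end ForceBudget

section BoundedEnstrophy

variable {ν T : ℝ} {f u : ℝ → EuclideanSpace ℝ (Fin 3) → EuclideanSpace ℝ (Fin 3)}
  {p : ℝ → EuclideanSpace ℝ (Fin 3) → ℝ}

/-- **Tao 2011, Cor. 11.1 WITH force, for a solution of finite total speed.** A classical solution
of the forced system (`ν > 0`) on `[0,T] × ℝ³` with smooth `H¹` data (`u(0) ∈ H¹`,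
`‖∇f‖_{L^∞_t L²_x} < ∞`), finite energy, finite dissipation `∫₀ᵀ∫|∇u|² < ∞` and finite total
speed `∫₀ᵀ‖u‖_{L^∞} < ∞` lies in `X¹([0,T] × ℝ³)`; the analytic leaves of the a priori theorem
(`Y₆`, the Fourier step) are the tree's theorems. [cite: Tao2011, Cor. 11.1 (arXiv Cor. 68, p. 36)] -/
theorem IsClassicalNSSolutionOn.memSobolevX_one_forced_of_totalSpeed (hν : 0 < ν) (hT : 0 < T)
    (hsol : FluidPDE.IsClassicalNSSolutionOn (Icc 0 T) ν f u p)
    (hfH1 : ∀ j ≤ 1, ∃ C : ℝ≥0, ∀ t ∈ Icc 0 T, ∫⁻ x, ‖iteratedFDeriv ℝ j (f t) x‖ₑ ^ 2 ≤ C)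
    (h₀ : ∫⁻ x, ‖iteratedFDeriv ℝ 1 (u 0) x‖ₑ ^ 2 < ⊤)
    (hE : ∃ C : ℝ≥0, ∀ t ∈ Icc 0 T, ∫⁻ x, ‖u t x‖ₑ ^ 2 ≤ C)
    (hD : ∫⁻ t in Ioo 0 T, ∫⁻ x, ENNReal.ofReal (FluidPDE.frobeniusNormSq (fderiv ℝ (u t) x)) < ⊤)
    (hM : ∫⁻ t in Ioo 0 T, eLpNorm (u t) ∞ volume < ⊤) :
    MemSobolevX 1 T u := by
  obtain ⟨C, hC⟩ := hE
  exact memSobolevX_one_forced_of_apriori tao2011_nonlinearEstimate_holds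
    tao2011_sobolev_of_vorticity_holds hν hT hsol ⟨C, ENNReal.coe_lt_top, hC⟩ hD hM h₀
    (forceBudget_lt_top_of_H1 hfH1)

end BoundedEnstrophy

section Uniqueness

/-- **Tao 2011, Cor. 11.4 (Unconditional uniqueness, arXiv Cor. 71) WITH FORCE, velocity form —
reduced to finite dissipation and finite total speed.** In exactly the dictionary of the named fact
`tao2011_forced_unconditionalUniqueness_velocity` (`ν > 0`; force smooth on the closed slab with
`‖f‖_{L^∞_t H¹_x} < ∞`; two classical solutions of the forced system on `[0,T] × ℝ³` with the same
`H¹` datum and finite energy): IF both solutions have finite dissipation `∫₀ᵀ∫|∇u|² < ∞`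
(Lemma 8.1 WITH force) and finite total speed `∫₀ᵀ‖u‖_{L^∞} < ∞` (Prop. 9.1 WITH force), then the
velocities coincide on `[0,T]`. Proof = Remark 11.3 WITH force: both lie in `X¹` (Cor. 11.1 WITH
force, `memSobolevX_one_forced_of_totalSpeed`) and `X¹` solutions with the same force and datum are
unique (`IsClassicalNSSolutionOn.eq_of_memSobolevX`, Cor. 4.3 + Thm. 5.4 (iii)). The hypothesis
`_hf` (smoothness of `f`) of the named fact is implied by the solution property and kept only to
match its binder list. [cite: Tao2011, Cor. 11.4 (arXiv Cor. 71, p. 36) + Remark 11.3] -/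
theorem tao2011_forced_unconditionalUniqueness_velocity_of_totalSpeed
    ⦃ν T : ℝ⦄ (hν : 0 < ν) (hT : 0 < T)
    ⦃f : ℝ → EuclideanSpace ℝ (Fin 3) → EuclideanSpace ℝ (Fin 3)⦄
    (_hf : FluidPDE.IsSmoothSpaceTimeOn (Icc 0 T) f)
    (hfH1 : ∀ j ≤ 1, ∃ C : ℝ≥0, ∀ t ∈ Icc 0 T, ∫⁻ x, ‖iteratedFDeriv ℝ j (f t) x‖ₑ ^ 2 ≤ C)
    ⦃u v : ℝ → EuclideanSpace ℝ (Fin 3) → EuclideanSpace ℝ (Fin 3)⦄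
    ⦃p q : ℝ → EuclideanSpace ℝ (Fin 3) → ℝ⦄
    (hu : FluidPDE.IsClassicalNSSolutionOn (Icc 0 T) ν f u p)
    (hv : FluidPDE.IsClassicalNSSolutionOn (Icc 0 T) ν f v q)
    (h₀ : ∀ j ≤ 1, ∫⁻ x, ‖iteratedFDeriv ℝ j (u 0) x‖ₑ ^ 2 < ⊤)
    (hdatum : v 0 = u 0)
    (huE : ∃ C : ℝ≥0, ∀ t ∈ Icc 0 T, ∫⁻ x, ‖u t x‖ₑ ^ 2 ≤ C)
    (hvE : ∃ C : ℝ≥0, ∀ t ∈ Icc 0 T, ∫⁻ x, ‖v t x‖ₑ ^ 2 ≤ C)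
    (huD : ∫⁻ t in Ioo 0 T, ∫⁻ x, ENNReal.ofReal (FluidPDE.frobeniusNormSq (fderiv ℝ (u t) x)) < ⊤)
    (hvD : ∫⁻ t in Ioo 0 T, ∫⁻ x, ENNReal.ofReal (FluidPDE.frobeniusNormSq (fderiv ℝ (v t) x)) < ⊤)
    (huM : ∫⁻ t in Ioo 0 T, eLpNorm (u t) ∞ volume < ⊤)
    (hvM : ∫⁻ t in Ioo 0 T, eLpNorm (v t) ∞ volume < ⊤) :
    ∀ t ∈ Icc 0 T, v t = u t := by
  have hXu : MemSobolevX 1 T u :=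
    hu.memSobolevX_one_forced_of_totalSpeed hν hT hfH1 (h₀ 1 le_rfl) huE huD huM
  have h₀v : ∫⁻ x, ‖iteratedFDeriv ℝ 1 (v 0) x‖ₑ ^ 2 < ⊤ := by rw [hdatum]; exact h₀ 1 le_rfl
  have hXv : MemSobolevX 1 T v :=
    hv.memSobolevX_one_forced_of_totalSpeed hν hT hfH1 h₀v hvE hvD hvM
  intro t ht
  exact hv.eq_of_memSobolevX hu hν hT hXv hXu hdatum ht

end Uniqueness

end Literature.Analysis.FluidPDE

end
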